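import Summits.Parity.GeneralizedHardyLittlewood.Theorems.Dhl42DefsCover

/-!
# DHL[42,2] certificate — monotonicity and sign facts of the tables; Proposition 5.3(ii) per grade

Exact-arithmetic verifications on the Section 7.1 data: nesting of the layers (`eps2_anti`,
`eps2C_pos`), strict monotonicity of the union grid and of the per-grade level vectors (with
sentinels), non-negativity of all per-grade thresholds, and Proposition 5.3(ii) for grades A, B, C
(`cond_iiA/B/C`: at every level either the budget inequality or the deep alternative). All by
`fin_cases` + `norm_num`.

Origin: the verbatim leg `Dhl42/TpY4Dhl42.lean` of the DHL[42,2] certificate package (pub-dhl42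
bundle, archive blob `18cce9e3`; paper snapshot = `paper/main.tex` v1), lines :1051–:1162;
statements and proofs unchanged except: namespace `TpY4Dhl42` →
`Summit.Parity.GeneralizedHardyLittlewood.Theorems.Dhl42`, the package's `simplexSet n B` replaced
by the tree's definitionally equal `Literature.NumberTheory.Sieve.scaledSimplex n B`
(`PolymathBoundedGaps.lean`), docstrings added where missing.

Declarations (15): `eps2_anti`, `eps2C_pos`, `uvecE_strictMono`, `levAE_strictMono`,
`levBE_strictMono`, `levCE_strictMono`, `tauFA_nonneg`, `tauGA_nonneg`, `tauFB_nonneg`,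
`tauGB_nonneg`, `tauFC_nonneg`, `tauGC_nonneg`, `cond_iiA`, `cond_iiB`, `cond_iiC`.
-/

namespace Summit.Parity.GeneralizedHardyLittlewood.Theorems.Dhl42

/-- `ε_{2,3} < ε_{2,2} < ε_{2,1}`: the layers are nested (Section 7.1). -/
theorem eps2_anti : eps2 2 < eps2 1 ∧ eps2 1 < eps2 0 := by
  rw [eps2A_eq, eps2B_eq, eps2C_eq]
  norm_num

/-- `0 < ε_{2,3}`: the deepest layer `[0, ε_{2,3})` is non-degenerate. -/
theorem eps2C_pos : 0 < eps2 2 := by rw [eps2C_eq]; norm_num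

/-- The union grid together with the sentinel is strictly increasing
(Table 2; data sanity for the banded form of Remark 5.4). -/
theorem uvecE_strictMono : StrictMono uvecE := by
  rw [Fin.strictMono_iff_lt_succ]
  intro i
  fin_cases i <;>
    norm_num [uvecE, Sc, eps, rho0, Matrix.cons_val_two, Matrix.head_cons, Matrix.tail_cons]

/-- Grade-A levels (with sentinel) are strictly increasing (Definition 5.2). -/
theorem levAE_strictMono : StrictMono levAE := by
  rw [Fin.strictMono_iff_lt_succ]
  intro i
  fin_cases i <;>
    norm_num [levAE, Sc, eps, rho0, Matrix.cons_val_two, Matrix.head_cons, Matrix.tail_cons]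

/-- Grade-B levels (with sentinel) are strictly increasing (Definition 5.2). -/
theorem levBE_strictMono : StrictMono levBE := by
  rw [Fin.strictMono_iff_lt_succ]
  intro i
  fin_cases i <;>
    norm_num [levBE, Sc, eps, rho0, Matrix.cons_val_two, Matrix.head_cons, Matrix.tail_cons]

/-- Grade-C levels (with sentinel) are strictly increasing (Definition 5.2). -/
theorem levCE_strictMono : StrictMono levCE := by
  rw [Fin.strictMono_iff_lt_succ]
  intro i
  fin_cases i <;>
    norm_num [levCE, Sc, eps, rho0, Matrix.cons_val_two, Matrix.head_cons, Matrix.tail_cons]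

/-- Every grade-A F-threshold `τ^{F,A}_j` is `≥ 0` (data sanity, by `norm_num` on the 22 exact
entries). -/
theorem tauFA_nonneg : ∀ j, 0 ≤ tauFA j := by
  intro j
  fin_cases j <;> norm_num [tauFA, Matrix.cons_val_two, Matrix.head_cons, Matrix.tail_cons]

/-- Every grade-A G-threshold `τ^{G,A}_j` is `≥ 0` (data sanity, by `norm_num` on the 22 exact
entries). -/
theorem tauGA_nonneg : ∀ j, 0 ≤ tauGA j := by
  intro j
  fin_cases j <;> norm_num [tauGA, Matrix.cons_val_two, Matrix.head_cons, Matrix.tail_cons]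

/-- Every grade-B F-threshold `τ^{F,B}_j` is `≥ 0` (data sanity, by `norm_num` on the 42 exact
entries). -/
theorem tauFB_nonneg : ∀ j, 0 ≤ tauFB j := by
  intro j
  fin_cases j <;> norm_num [tauFB, Matrix.cons_val_two, Matrix.head_cons, Matrix.tail_cons]

/-- Every grade-B G-threshold `τ^{G,B}_j` is `≥ 0` (data sanity, by `norm_num` on the 42 exact
entries). -/
theorem tauGB_nonneg : ∀ j, 0 ≤ tauGB j := by
  intro j
  fin_cases j <;> norm_num [tauGB, Matrix.cons_val_two, Matrix.head_cons, Matrix.tail_cons]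

/-- Every grade-C F-threshold `τ^{F,C}_j` is `≥ 0` (data sanity, by `norm_num` on the 46 exact
entries). -/
theorem tauFC_nonneg : ∀ j, 0 ≤ tauFC j := by
  intro j
  fin_cases j <;> norm_num [tauFC, Matrix.cons_val_two, Matrix.head_cons, Matrix.tail_cons]

/-- Every grade-C G-threshold `τ^{G,C}_j` is `≥ 0` (data sanity, by `norm_num` on the 46 exact
entries). -/
theorem tauGC_nonneg : ∀ j, 0 ≤ tauGC j := by
  intro j
  fin_cases j <;> norm_num [tauGC, Matrix.cons_val_two, Matrix.head_cons, Matrix.tail_cons]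

/-- Proposition 5.3(ii) for grade A (`i = 1`, so the budget is
`L_1 + c_1 - u_{j+1} - (2k+1+1)ρ₀`, `k = 42`): at every level the first
alternative holds (an equality at every level where the threshold pair was
set from the budget, i.e. wherever `τ^F > 0`; at the level with
`τ^F = τ^G = 0` it is a strict inequality against a positive budget). -/
theorem cond_iiA : ∀ j : Fin 22,
    tauFA j + tauGA j ≤ Lg 0 + cg 0 - 1 * levAE j.succ - (2 * 42 + 1 + 1) * rho0 ∨
      (tauFA j < levA j ∧ tauGA j < levA j) := by
  intro j
  fin_cases j <;>
    · left
      norm_num [tauFA, tauGA, levAE, Lg0_eq, cg0_eq, rho0, Sc, eps, Matrix.cons_val_two,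
        Matrix.head_cons, Matrix.tail_cons]

/-- Proposition 5.3(ii) for grade B (`i = 2`: budget
`L_2 + c_2 - 2u_{j+1} - (2k+1+2)ρ₀`): first alternative everywhere except the
top level `u_{41} = 0.95` (negative budget), which satisfies the second. -/
theorem cond_iiB : ∀ j : Fin 42,
    tauFB j + tauGB j ≤ Lg 1 + cg 1 - 2 * levBE j.succ - (2 * 42 + 1 + 2) * rho0 ∨
      (tauFB j < levB j ∧ tauGB j < levB j) := by
  intro j
  fin_cases j <;>
    first
      | (left
         norm_num [tauFB, tauGB, levBE, Lg1_eq, cg1_eq, rho0, Sc, eps, Matrix.cons_val_two,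
           Matrix.head_cons, Matrix.tail_cons]
         done)
      | (right
         constructor <;>
           norm_num [tauFB, tauGB, levB, levBE, Matrix.cons_val_two, Matrix.head_cons,
             Matrix.tail_cons])

/-- Proposition 5.3(ii) for grade C (`i = 2`): first alternative everywhere
except the top level `u_{45} = 0.95` (negative budget). -/
theorem cond_iiC : ∀ j : Fin 46,
    tauFC j + tauGC j ≤ Lg 2 + cg 2 - 2 * levCE j.succ - (2 * 42 + 1 + 2) * rho0 ∨
      (tauFC j < levC j ∧ tauGC j < levC j) := by
  intro j
  fin_cases j <;>
    first
      | (left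
         norm_num [tauFC, tauGC, levCE, Lg2_eq, cg2_eq, rho0, Sc, eps, Matrix.cons_val_two,
           Matrix.head_cons, Matrix.tail_cons]
         done)
      | (right
         constructor <;>
           norm_num [tauFC, tauGC, levC, levCE, Matrix.cons_val_two, Matrix.head_cons,
             Matrix.tail_cons])

end Summit.Parity.GeneralizedHardyLittlewood.Theorems.Dhl42
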